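import Summits.CriticalPhenomena.PercolationContinuityZ3.Theorems.PercNearOneGluingNoHeavyLowerTailSahiTransportRho

/-!
# `NoHeavyLowerTail` (crux stmt-CriticalPhenomena-4575), Sahi / Kahn positivity: TRANSPORT CERTIFICATES (V-e) —
# how negative can conditioning on an increasing event make the correlation of two increasing events?

Support file (cell `prim-l12`, seat P3, gen 7; `--supports stmt-CriticalPhenomena-4575`).  No `sorry`, no named facts, standard axioms.
New mathematics (this programme; elementary).

Conditioning a product measure on an increasing event `H` destroys positive association: `μ(X ∩ Z | H) < μ(X | H) μ(Z | H)` is possible for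
increasing `X, Z` (e.g. `H = a ∨ b`, `X = {a}↑`, `Z = {b}↑`).  This negative conditional covariance is exactly the obstruction `ν'(γ)` in the
seat's identity (ID5) for the binary product rule of transport certificates (memo FROM-prim-l12-p3-g7-CASCADE-RULES.md §1).  Here we bound
it by the BOOSTS `Δ_X = μ(X | H) − μ(X) ≥ 0`:
  `μ(X|H) μ(Z|H) − μ(X∩Z|H) ≤ Δ_X Δ_Z + √(μ(X) μ(Z) Δ_X Δ_Z)`,
with equality for `H = a ∨ b`, `X = {a}↑`, `Z = {b}↑` at every parameter vector (`pr_condCov_neg_le`, stated multiplied through by `μ(H)²`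
to avoid divisions: `D_X = μ(H∩X) − μ(H)μ(X) = μ(H)Δ_X`).  Proof: Harris for `X` and `H ∩ Z` (and symmetrically) gives
`μ(HX)μ(HZ) − μ(H)μ(HXZ) ≤ D_X D_Z + μ(H)·min(μ(Z) D_X, μ(X) D_Z)`, and `min ≤` geometric mean.  This is the nonlinear (square-root)
single-factor inequality which the seat's exact LPs show cannot be replaced by a linear consequence of the certificate axioms; it is tight on
`6.4·10⁶` exhaustively tested `(H, X, Z, p)` with `k ≤ 4` (max ratio `1`). [this work]
-/

noncomputable section

open scoped Classical

namespace Summit.CriticalPhenomena.PercolationContinuityZ3.Theorems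

namespace SahiTransportCert

open Finset
open SahiHittingSlot

variable {k : ℕ}

/-- **The negative conditional covariance bound.**  For increasing families `H, X, Z` of the pattern cube, with `D_X = μ(H∩X) − μ(H)μ(X) ≥ 0`,
`D_Z` likewise (Harris):
`μ(H∩X) μ(H∩Z) − μ(H) μ(H∩X∩Z) ≤ D_X D_Z + μ(H) √(μ(X) μ(Z) D_X D_Z)`,
i.e. `μ(X|H)μ(Z|H) − μ(X∩Z|H) ≤ Δ_XΔ_Z + √(μ(X)μ(Z)Δ_XΔ_Z)` with `Δ = D/μ(H)`; equality for `H = a ∨ b`, `X = {a}↑`, `Z = {b}↑`. [this work] -/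
theorem pr_condCov_neg_le (q : Fin k → unitInterval) {H X Z : Set (Set (Fin k))} (hH : IsUpperSet H) (hX : IsUpperSet X) (hZ : IsUpperSet Z) :
    pr q (H ∩ X) * pr q (H ∩ Z) - pr q H * pr q (H ∩ (X ∩ Z)) ≤
      (pr q (H ∩ X) - pr q H * pr q X) * (pr q (H ∩ Z) - pr q H * pr q Z)
        + pr q H * Real.sqrt (pr q X * pr q Z * ((pr q (H ∩ X) - pr q H * pr q X) * (pr q (H ∩ Z) - pr q H * pr q Z))) := by
  -- Harris: the boosts are nonnegative, and the two mixed inequalities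
  have hDX : pr q H * pr q X ≤ pr q (H ∩ X) := pr_mul_pr_le_pr_inter q hH hX
  have hDZ : pr q H * pr q Z ≤ pr q (H ∩ Z) := pr_mul_pr_le_pr_inter q hH hZ
  have h1 : pr q X * pr q (H ∩ Z) ≤ pr q (H ∩ (X ∩ Z)) := by
    have := pr_mul_pr_le_pr_inter q hX (hH.inter hZ); rwa [Set.inter_left_comm] at this
  have h2 : pr q (H ∩ X) * pr q Z ≤ pr q (H ∩ (X ∩ Z)) := by
    have := pr_mul_pr_le_pr_inter q (hH.inter hX) hZ; rwa [Set.inter_assoc] at this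
  have hθ : 0 ≤ pr q H := pr_nonneg q H
  have hx : 0 ≤ pr q X := pr_nonneg q X
  have hz : 0 ≤ pr q Z := pr_nonneg q Z
  set DX := pr q (H ∩ X) - pr q H * pr q X with hDXdef
  set DZ := pr q (H ∩ Z) - pr q H * pr q Z with hDZdef
  have hDX0 : 0 ≤ DX := sub_nonneg.2 hDX
  have hDZ0 : 0 ≤ DZ := sub_nonneg.2 hDZ
  -- the two linear bounds: LHS ≤ DX·DZ + θ·(μZ·DX) and LHS ≤ DX·DZ + θ·(μX·DZ)
  have hb1 : pr q (H ∩ X) * pr q (H ∩ Z) - pr q H * pr q (H ∩ (X ∩ Z)) ≤ DX * DZ + pr q H * (pr q Z * DX) := by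
    have : pr q (H ∩ X) * pr q (H ∩ Z) - pr q H * pr q (H ∩ (X ∩ Z)) ≤ pr q (H ∩ X) * pr q (H ∩ Z) - pr q H * (pr q X * pr q (H ∩ Z)) := by
      nlinarith [mul_le_mul_of_nonneg_left h1 hθ]
    have e : pr q (H ∩ X) * pr q (H ∩ Z) - pr q H * (pr q X * pr q (H ∩ Z)) = DX * DZ + pr q H * (pr q Z * DX) := by
      simp only [hDXdef, hDZdef]; ring
    linarith
  have hb2 : pr q (H ∩ X) * pr q (H ∩ Z) - pr q H * pr q (H ∩ (X ∩ Z)) ≤ DX * DZ + pr q H * (pr q X * DZ) := by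
    have : pr q (H ∩ X) * pr q (H ∩ Z) - pr q H * pr q (H ∩ (X ∩ Z)) ≤ pr q (H ∩ X) * pr q (H ∩ Z) - pr q H * (pr q (H ∩ X) * pr q Z) := by
      nlinarith [mul_le_mul_of_nonneg_left h2 hθ]
    have e : pr q (H ∩ X) * pr q (H ∩ Z) - pr q H * (pr q (H ∩ X) * pr q Z) = DX * DZ + pr q H * (pr q X * DZ) := by
      simp only [hDXdef, hDZdef]; ring
    linarith
  -- min ≤ geometric mean
  have hmin : min (pr q Z * DX) (pr q X * DZ) ≤ Real.sqrt (pr q X * pr q Z * (DX * DZ)) := by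
    -- `min u v ≤ √(u v)` for the two nonnegative quantities `u = μZ·D_X`, `v = μX·D_Z`
    have hu : 0 ≤ pr q Z * DX := mul_nonneg hz hDX0
    have hv : 0 ≤ pr q X * DZ := mul_nonneg hx hDZ0
    have e : pr q Z * DX * (pr q X * DZ) = pr q X * pr q Z * (DX * DZ) := by ring
    rw [← e]
    rcases le_total (pr q Z * DX) (pr q X * DZ) with h | h
    · rw [min_eq_left h]
      calc pr q Z * DX = Real.sqrt (pr q Z * DX * (pr q Z * DX)) := (Real.sqrt_mul_self hu).symm
        _ ≤ Real.sqrt (pr q Z * DX * (pr q X * DZ)) := Real.sqrt_le_sqrt (mul_le_mul_of_nonneg_left h hu)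
    · rw [min_eq_right h]
      calc pr q X * DZ = Real.sqrt (pr q X * DZ * (pr q X * DZ)) := (Real.sqrt_mul_self hv).symm
        _ ≤ Real.sqrt (pr q Z * DX * (pr q X * DZ)) := Real.sqrt_le_sqrt (mul_le_mul_of_nonneg_right h hv)
  have hle : pr q (H ∩ X) * pr q (H ∩ Z) - pr q H * pr q (H ∩ (X ∩ Z)) ≤ DX * DZ + pr q H * min (pr q Z * DX) (pr q X * DZ) := by
    rcases le_total (pr q Z * DX) (pr q X * DZ) with h | h
    · rw [min_eq_left h]; exact hb1
    · rw [min_eq_right h]; exact hb2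
  exact hle.trans (by nlinarith [mul_le_mul_of_nonneg_left hmin hθ])

end SahiTransportCert

end Summit.CriticalPhenomena.PercolationContinuityZ3.Theorems
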